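import Summits.QuantumFields.GaugeBoot.TiltedBoxOddMidAxisRPTwoDimAnnuli
import Literature.MathematicalPhysics.QuantumFieldTheory.LatticeSiteRPMechanism
import HarnessLib

/-!
# Reduced-half link reflection positivity on the odd square tilted box in two dimensions (gauge-boot, L3 supplement: 2D slab gluing, reduced-half link mirror 4b/4)

HONEST FRAMING (cell `pub-gaugeboot`, page 1 of every file): the venture produces certified bounds
on lattice expectations at stated coupling, gauge group, dimension and torus size; NOT a mass gap,
NOT a continuum limit, NOT a string tension; NOT Yang–Mills-summit-bearing (barriers
`FixedCouplingUltralocality`, `PerturbativeInvisibility`). A structural POSITIVE result about a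
reflection of a two-dimensional periodic box; it bounds no expectation of the venture's tables.

`TiltedBoxOddMidAxisRPNegative.lean` proved: on the square tilted box `ℤ^d/Γ(2P+1, 2P+1, L)` the
in-plane LINK mirror `Θ_mid : x_i ↦ 1 - x_i` is NOT of positive type for the closed half
`{1 ≤ x_i ≤ P + 1}` at ANY real `β`, in EVERY `d ≥ 2` — the layer `x_i ≡ P + 1` is mapped onto itself
twisted by the half period `T`, and a two-link observable of that layer is a witness. This module proves
that the twisted layer is the ONLY obstruction in two dimensions:

* **`tiltedBox_midAxisRP_odd_twoDim`** — two directions (`∀ k, k = i ∨ k = j`), `P ≥ 1`, every compact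
  second countable `G`, every continuous `ρ`, EVERY real `β`: `0 ≤ ∫ conj F(Θ_mid U) · F(U) dμ_β` for
  every bounded measurable observable `F` of the REDUCED half `{1 ≤ x_i ≤ P}` (`F U = F V` whenever `U`,
  `V` agree on the links with both endpoints in it, `IsRedLink`; the shape refuted for `P + 1` in place of
  `P` by `not_tiltedBox_midAxisRP_odd`).

**Proof.** The reduced half leaves the twisted layer FREE: between the half (top layer `P`) and its
mirror image (bottom layer `P + 2`) sit two annuli and the free layer; below, the exact annulus `0|1`.
The Boltzmann weight splits into `h = g·conj(g∘Θ)` (`g = F e^{-βE}`, `E = redExpo`) and three annulus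
products (`boltzmann_split_red`); Migdal's recursion integrates the rungs of the three annuli
(`SlabKernel.integral_mul_annulus`, thrice), leaving `k_ψ(w₀, w₁) · k_ψ(w_P, w_{P+1}) · k_ψ(w_{P+1}, w_{P+2})`,
`ψ = ω_β^{⋆(2P+1)}`, of the layer words; integrating ONE letter of the free word `w_{P+1}` (Haar
distributed) composes the two upper kernels into the two-layer kernel `K_ψ(w_P, w_{P+2}) = ∫ k_ψ(w_P, g)
k_ψ(w_{P+2}, g) dg` (`SlabKernelTwoLayer.lean`); the lower annulus is exact (`w₁ ∘ Θ = w₀`) and `w_{P+2}` is a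
conjugate of `w_P ∘ Θ` (the twist rotates the word), invisible to `K_ψ`. The Gram forms of `k_ψ` and `K_ψ`
turn the integral into `∫∫ (∫ Ψ_{u,g} conj(Ψ_{u,g} ∘ Θ) dμ₀) du dg` with `Ψ_{u,g} = g · e_ψ(w₁, u) · k_ψ(w_P, g)`
an observable of the positive links, and the tree's mechanism
`LatticeRP.integral_splice_mul_conj_comp_of_shared_nonneg` (empty shared block) makes each inner integral
non-negative. No character expansion, no sign condition on `β`.

Consequence (separate module): two-dimensional tilted limit points along odd boxes are link-RP along
both in-plane axes as well, hence carry EVERY Class-B constraint. Small new positive result; mechanism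
folklore (Migdal 1975, Osterwalder–Seiler 1978).

References: A. A. Migdal, Sov. Phys. JETP 42 (1975) 413; K. Osterwalder, E. Seiler, Ann. Phys. 110
(1978) 440, §2; J. Fröhlich, R. Israel, E. H. Lieb, B. Simon, J. Stat. Phys. 22 (1980) 297, §3;
M. Biskup, in LNM 1970 (2009) §5.4–5.5.
-/

noncomputable section

open MeasureTheory Complex Function
open scoped ComplexOrder ComplexConjugate
open Literature.MathematicalPhysics.QuantumFieldTheory (haarProbability)
open Literature.MathematicalPhysics.QuantumFieldTheory.LatticeRP (piMeasure splice splice_eq_piecewise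
  integral_splice_mul_conj_comp_of_shared_nonneg)
open Literature.RepresentationTheory.CompactGroups

namespace Summit.QuantumFields.GaugeBoot

namespace TiltedRP

namespace TwoDim

variable {d : ℕ} {i j : Fin d} {L P N : ℕ} [NeZero L] [NeZero P]
variable {G : Type*} [Group G] [TopologicalSpace G] [IsTopologicalGroup G] [CompactSpace G]
  [MeasurableSpace G] [BorelSpace G] [SecondCountableTopology G]
variable (ρ : G →* Matrix (Fin N) (Fin N) ℂ)

/-! ## The main theorem -/

/-- The observable of the mechanism at the feature parameters `(u, g)`:
`Ψ_{u,g} = g_red · e_ψ(w₁, u) · k_ψ(w_P, g)`. -/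
def psiRed (β : ℝ) (F : Config (TiltedSite d i j (2 * P + 1) (2 * P + 1) L) d G → ℂ) (u g : G)
    (U : Config (TiltedSite d i j (2 * P + 1) (2 * P + 1) L) d G) : ℂ :=
  gRed ρ β F U * (SlabKernel.featureMap (psiR P ρ β) (wLoR U) u : ℂ) * (SlabKernel.slabKernel (psiR P ρ β) (wUpR U) g : ℂ)

/-- **Pointwise in the feature parameters, the mechanism applies** (empty shared block, no crossing
links): `0 ≤ ∫ Ψ_{u,g}(U) conj Ψ_{u,g}(Θ_mid U) dU`. [folklore] -/
theorem integral_psiRed_nonneg [DecidableEq (TiltedSite d i j (2 * P + 1) (2 * P + 1) L)] (hij : i ≠ j)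
    (hd : ∀ k : Fin d, k = i ∨ k = j) (hρ : Continuous ρ) (β : ℝ)
    {F : Config (TiltedSite d i j (2 * P + 1) (2 * P + 1) L) d G → ℂ} (hFm : Measurable F) {CF : ℝ} (hFb : ∀ U, ‖F U‖ ≤ CF)
    (hFo : ∀ U V : Config (TiltedSite d i j (2 * P + 1) (2 * P + 1) L) d G, (∀ l, IsRedLink l → U l = V l) → F U = F V) (u g : G) :
    0 ≤ ∫ U, psiRed ρ β F u g U * conj (psiRed ρ β F u g (configMidReflect (tiltedUnit d i j (2 * P + 1) (2 * P + 1) L) i (tiltedAxisFlip d L (2 * P + 1) hij) U))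
      ∂(productHaar (TiltedSite d i j (2 * P + 1) (2 * P + 1) L) d G) := by
  haveI : IsProbabilityMeasure (haarProbability G) := CompactGroup.isProbabilityMeasure_haarMeasure_top
  have hP : 1 ≤ P := one_le_P
  obtain ⟨hgm, Cg, hgb⟩ := measurable_gRed_and_bound ρ hρ β hFm hFb
  have hψc : Continuous (psiR P ρ β) := SlabKernel.continuous_convPow (SlabKernel.continuous_wilsonWt ρ hρ β) _
  obtain ⟨Cψ, -, hCψ⟩ := Literature.MathematicalPhysics.QuantumLattice.exists_forall_abs_le_of_continuous hψc
  obtain ⟨Ck, hCk0, hCk⟩ := SlabKernel.exists_abs_slabKernel_le hψc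
  obtain ⟨hw1, hwP, -, -⟩ := continuous_wordsR (L := L) (P := P) (i := i) (j := j) (d := d) (G := G)
  have hΨm : Measurable (psiRed ρ β F u g) :=
    (hgm.mul (Complex.measurable_ofReal.comp ((SlabKernel.continuous_featureMap_left hψc u).comp hw1).measurable)).mul
      (Complex.measurable_ofReal.comp (((SlabKernel.continuous_uncurry_slabKernel hψc).comp
        (hwP.prodMk continuous_const)).measurable))
  have hCψ0 : 0 ≤ Cψ := (abs_nonneg _).trans (hCψ 1)
  have hΨb : ∀ U, ‖psiRed ρ β F u g U‖ ≤ Cg * Cψ * Ck := fun U => by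
    rw [psiRed, norm_mul, norm_mul, Complex.norm_real, Complex.norm_real, Real.norm_eq_abs, Real.norm_eq_abs]
    exact mul_le_mul (mul_le_mul (hgb U) (SlabKernel.abs_featureMap_le hCψ _ _) (abs_nonneg _)
      ((norm_nonneg _).trans (hgb U))) (hCk _ _) (abs_nonneg _) (mul_nonneg ((norm_nonneg _).trans (hgb U)) hCψ0)
  have hΨdep : DependsOn (psiRed ρ β F u g) ((posBlockR d i j L P ∪ ∅ ∪ ∅ : Finset _) : Set _) := by
    intro U V hUV
    simp only [Finset.union_empty] at hUV
    have hpos : ∀ l ∈ posBlockR d i j L P, U l = V l := fun l hl => hUV l (by rw [Finset.mem_coe]; exact hl)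
    have h1 : wLoR U = wLoR V := by
      unfold wLoR SlabKernel.oprod
      congr 1
      refine List.map_congr_left fun t _ => hUV _ ?_
      rw [Finset.mem_coe]
      refine jLink_mem_posBlockR (Or.inl ?_)
      have hM1 : 2 * P + 1 ≠ 1 := by omega
      rw [axisCoord_add_tiltedUnit, if_pos rfl, axisCoord_cyc hij, map_zero, zero_add, ZMod.val_one'' hM1]
    have h2 : wUpR U = wUpR V := by
      unfold wUpR SlabKernel.oprod
      congr 1
      refine List.map_congr_left fun t _ => hUV _ ?_
      rw [Finset.mem_coe]
      exact jLink_mem_posBlockR (Or.inr (by rw [axisCoord_cyc hij, val_axisCoord_oddLayerSite]))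
    simp only [psiRed, gRed_eq_of_posLinks ρ hij hd β hFo hpos, h1, h2]
  have key := integral_splice_mul_conj_comp_of_shared_nonneg (haarProbability G) ∅ (posBlockR d i j L P) ∅ _
    (measurePreserving_configMidReflect_flip_odd (L := L) (P := P) (G := G) hij) (fun U l hl => by simp at hl)
    (fun l hl => dependsOn_configMidReflect_apply_odd hij hd l hl) (Finset.disjoint_empty_left _)
    (Finset.disjoint_empty_left _) hΨm hΨb hΨdep
  simp only [splice_eq_piecewise, Finset.piecewise_empty] at key
  unfold productHaar
  rwa [integral_fun_fst (fun U => psiRed ρ β F u g U * conj (psiRed ρ β F u g (configMidReflect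
      (tiltedUnit d i j (2 * P + 1) (2 * P + 1) L) i (tiltedAxisFlip d L (2 * P + 1) hij) U))), probReal_univ, one_smul] at key

/-- **After the annuli: the double Gram form is non-negative**,
`0 ≤ ∫ h · k_ψ(w₁, w₁∘Θ) · K_ψ(w_P, w_P∘Θ) dμ₀` (Fubini over the two feature parameters). [folklore] -/
theorem integral_hRed_kernels_nonneg [DecidableEq (TiltedSite d i j (2 * P + 1) (2 * P + 1) L)] (hij : i ≠ j)
    (hd : ∀ k : Fin d, k = i ∨ k = j) (hρ : Continuous ρ) (β : ℝ)
    {F : Config (TiltedSite d i j (2 * P + 1) (2 * P + 1) L) d G → ℂ} (hFm : Measurable F) {CF : ℝ} (hFb : ∀ U, ‖F U‖ ≤ CF)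
    (hFo : ∀ U V : Config (TiltedSite d i j (2 * P + 1) (2 * P + 1) L) d G, (∀ l, IsRedLink l → U l = V l) → F U = F V) :
    0 ≤ ∫ U, hRed ρ β F hij U * (SlabKernel.slabKernel (psiR P ρ β) (wLoR U)
        (wLoR (configMidReflect (tiltedUnit d i j (2 * P + 1) (2 * P + 1) L) i (tiltedAxisFlip d L (2 * P + 1) hij) U)) : ℂ) *
      (SlabKernel.slabKernel₂ (psiR P ρ β) (wUpR U)
        (wUpR (configMidReflect (tiltedUnit d i j (2 * P + 1) (2 * P + 1) L) i (tiltedAxisFlip d L (2 * P + 1) hij) U)) : ℂ)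
      ∂(productHaar (TiltedSite d i j (2 * P + 1) (2 * P + 1) L) d G) := by
  haveI : IsProbabilityMeasure (haarProbability G) := CompactGroup.isProbabilityMeasure_haarMeasure_top
  haveI : IsFiniteMeasure (productHaar (TiltedSite d i j (2 * P + 1) (2 * P + 1) L) d G) := by unfold productHaar; infer_instance
  obtain ⟨hhm, Ch, hhb⟩ := measurable_hRed_and_bound ρ hij hρ β hFm hFb
  have hωc := SlabKernel.continuous_wilsonWt ρ hρ β
  have hωz := SlabKernel.wilsonWt_central ρ β
  have hψc : Continuous (psiR P ρ β) := SlabKernel.continuous_convPow hωc _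
  have hψz : ∀ g h, psiR P ρ β (h * g * h⁻¹) = psiR P ρ β g := SlabKernel.convPow_central hωz (2 * P + 1)
  have hψi : ∀ g, psiR P ρ β g⁻¹ = psiR P ρ β g :=
    SlabKernel.convPow_inv hωz (SlabKernel.wilsonWt_inv ρ hρ β) (2 * P + 1)
  obtain ⟨hw1, hwP, -, -⟩ := continuous_wordsR (L := L) (P := P) (i := i) (j := j) (d := d) (G := G)
  have hkc : Continuous fun q : G × G => SlabKernel.slabKernel (psiR P ρ β) q.1 q.2 :=
    SlabKernel.continuous_uncurry_slabKernel hψc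
  obtain ⟨Ck, hCk0, hCk⟩ := SlabKernel.exists_abs_slabKernel_le hψc
  have hCk' : ∀ a b : G, ‖(SlabKernel.slabKernel (psiR P ρ β) a b : ℂ)‖ ≤ Ck := fun a b => by
    rw [Complex.norm_real, Real.norm_eq_abs]; exact hCk a b
  have hΘc := continuous_configMidReflect_flip_odd (L := L) (P := P) (G := G) hij
  -- Step 5: Gram form of the two-layer kernel
  obtain ⟨Φ₁, hΦ₁⟩ : ∃ Φ : Config (TiltedSite d i j (2 * P + 1) (2 * P + 1) L) d G → ℂ, Φ = fun U => hRed ρ β F hij U *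
    (SlabKernel.slabKernel (psiR P ρ β) (wLoR U)
      (wLoR (configMidReflect (tiltedUnit d i j (2 * P + 1) (2 * P + 1) L) i (tiltedAxisFlip d L (2 * P + 1) hij) U)) : ℂ) := ⟨_, rfl⟩
  have hk1c : Continuous fun U : Config (TiltedSite d i j (2 * P + 1) (2 * P + 1) L) d G =>
      (SlabKernel.slabKernel (psiR P ρ β) (wLoR U)
        (wLoR (configMidReflect (tiltedUnit d i j (2 * P + 1) (2 * P + 1) L) i (tiltedAxisFlip d L (2 * P + 1) hij) U)) : ℂ) :=
    Complex.continuous_ofReal.comp (hkc.comp (hw1.prodMk (hw1.comp hΘc)))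
  have hΦ₁m : Measurable Φ₁ := by
    rw [hΦ₁]
    exact hhm.mul hk1c.measurable
  have hΦ₁b : ∀ U, ‖Φ₁ U‖ ≤ Ch * Ck := fun U => by
    rw [hΦ₁, norm_mul]
    exact mul_le_mul (hhb U) (hCk' _ _) (norm_nonneg _) ((norm_nonneg _).trans (hhb U))
  have hsplit₁ : ∀ U, hRed ρ β F hij U * (SlabKernel.slabKernel (psiR P ρ β) (wLoR U)
        (wLoR (configMidReflect (tiltedUnit d i j (2 * P + 1) (2 * P + 1) L) i (tiltedAxisFlip d L (2 * P + 1) hij) U)) : ℂ) *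
      (SlabKernel.slabKernel₂ (psiR P ρ β) (wUpR U)
        (wUpR (configMidReflect (tiltedUnit d i j (2 * P + 1) (2 * P + 1) L) i (tiltedAxisFlip d L (2 * P + 1) hij) U)) : ℂ) =
      Φ₁ U * (SlabKernel.slabKernel₂ (psiR P ρ β) (wUpR U)
        (wUpR (configMidReflect (tiltedUnit d i j (2 * P + 1) (2 * P + 1) L) i (tiltedAxisFlip d L (2 * P + 1) hij) U)) : ℂ) :=
    fun U => by rw [hΦ₁]
  simp_rw [hsplit₁]
  rw [SlabKernel.integral_mul_slabKernel₂_eq (productHaar (TiltedSite d i j (2 * P + 1) (2 * P + 1) L) d G) (Φ := Φ₁)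
    (a := wUpR) (b := fun U => wUpR (configMidReflect (tiltedUnit d i j (2 * P + 1) (2 * P + 1) L) i (tiltedAxisFlip d L (2 * P + 1) hij) U))
    hψc hΦ₁m hΦ₁b hwP.measurable (hwP.comp hΘc).measurable]
  refine integral_nonneg_of_complex fun g => ?_
  -- Step 6: Gram form of the lower kernel
  obtain ⟨E, hE⟩ : ∃ E : Config (TiltedSite d i j (2 * P + 1) (2 * P + 1) L) d G → ℂ, E = fun U =>
    (SlabKernel.slabKernel (psiR P ρ β) (wUpR U) g : ℂ) *
      (SlabKernel.slabKernel (psiR P ρ β)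
        (wUpR (configMidReflect (tiltedUnit d i j (2 * P + 1) (2 * P + 1) L) i (tiltedAxisFlip d L (2 * P + 1) hij) U)) g : ℂ) := ⟨_, rfl⟩
  have hEc : Continuous fun U : Config (TiltedSite d i j (2 * P + 1) (2 * P + 1) L) d G =>
      (SlabKernel.slabKernel (psiR P ρ β) (wUpR U) g : ℂ) *
        (SlabKernel.slabKernel (psiR P ρ β)
          (wUpR (configMidReflect (tiltedUnit d i j (2 * P + 1) (2 * P + 1) L) i (tiltedAxisFlip d L (2 * P + 1) hij) U)) g : ℂ) :=
    (Complex.continuous_ofReal.comp (hkc.comp (hwP.prodMk continuous_const))).mul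
      (Complex.continuous_ofReal.comp (hkc.comp ((hwP.comp hΘc).prodMk continuous_const)))
  have hEm : Measurable E := by
    rw [hE]
    exact hEc.measurable
  have hEb : ∀ U, ‖E U‖ ≤ Ck * Ck := fun U => by
    rw [hE, norm_mul]
    exact mul_le_mul (hCk' _ _) (hCk' _ _) (norm_nonneg _) hCk0
  obtain ⟨Φ₂, hΦ₂⟩ : ∃ Φ : Config (TiltedSite d i j (2 * P + 1) (2 * P + 1) L) d G → ℂ, Φ = fun U => hRed ρ β F hij U * E U :=
    ⟨_, rfl⟩
  have hreorder : ∀ U, Φ₁ U * ((SlabKernel.slabKernel (psiR P ρ β) (wUpR U) g : ℂ) *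
      (SlabKernel.slabKernel (psiR P ρ β)
        (wUpR (configMidReflect (tiltedUnit d i j (2 * P + 1) (2 * P + 1) L) i (tiltedAxisFlip d L (2 * P + 1) hij) U)) g : ℂ)) =
      Φ₂ U * (SlabKernel.slabKernel (psiR P ρ β) (wLoR U)
        (wLoR (configMidReflect (tiltedUnit d i j (2 * P + 1) (2 * P + 1) L) i (tiltedAxisFlip d L (2 * P + 1) hij) U)) : ℂ) :=
    fun U => by simp only [hΦ₁, hΦ₂, hE]; ring
  simp_rw [hreorder]
  rw [SlabKernel.integral_mul_slabKernel_eq (productHaar (TiltedSite d i j (2 * P + 1) (2 * P + 1) L) d G)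
    (Φ := Φ₂) (a := wLoR)
    (b := fun U => wLoR (configMidReflect (tiltedUnit d i j (2 * P + 1) (2 * P + 1) L) i (tiltedAxisFlip d L (2 * P + 1) hij) U))
    hψc hψz hψi (by rw [hΦ₂]; exact hhm.mul hEm) (K := Ch * (Ck * Ck))
    (fun U => by rw [hΦ₂, norm_mul]; exact mul_le_mul (hhb U) (hEb U) (norm_nonneg _) ((norm_nonneg _).trans (hhb U)))
    hw1.measurable (hw1.comp hΘc).measurable]
  refine integral_nonneg_of_complex fun u => ?_
  -- Step 7: pointwise in `(u, g)`
  have key := integral_psiRed_nonneg ρ hij hd hρ β hFm hFb hFo u g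
  have heq : ∀ U, Φ₂ U * ((SlabKernel.featureMap (psiR P ρ β) (wLoR U) u : ℂ) *
      (SlabKernel.featureMap (psiR P ρ β)
        (wLoR (configMidReflect (tiltedUnit d i j (2 * P + 1) (2 * P + 1) L) i (tiltedAxisFlip d L (2 * P + 1) hij) U)) u : ℂ)) =
      psiRed ρ β F u g U * conj (psiRed ρ β F u g (configMidReflect (tiltedUnit d i j (2 * P + 1) (2 * P + 1) L) i
        (tiltedAxisFlip d L (2 * P + 1) hij) U)) := fun U => by
    simp only [hΦ₂, hE, psiRed, hRed, map_mul, Complex.conj_ofReal]; ring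
  simp_rw [heq]
  exact key

/-- **Reflection positivity of the hybrid LINK mirror of the ODD square tilted box, for the REDUCED
half, in two dimensions.** On `ℤ^d/Γ(2P+1, 2P+1, L)` with `d = 2` directions (`∀ k, k = i ∨ k = j`),
`P ≥ 1`, for a compact second countable group `G`, a continuous matrix representation `ρ` and EVERY real
`β`: for every bounded measurable `F` reading only the links with both endpoints in `{1 ≤ x_i ≤ P}`
(`IsRedLink`; the twisted layer `x_i ≡ P + 1` excluded), `0 ≤ ∫ conj F(Θ_mid U) F(U) dμ_β(U)`, `Θ_mid`
the link mirror `x_i ↦ 1 - x_i`. (With `P + 1` in place of `P` this fails at every `β` in every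
`d ≥ 2`: `not_tiltedBox_midAxisRP_odd`.) Small new positive result; 2D YM gluing across a free layer. -/
theorem tiltedBox_midAxisRP_odd_twoDim (hij : i ≠ j) (hd : ∀ k : Fin d, k = i ∨ k = j) (hρ : Continuous ρ)
    (β : ℝ) (F : Config (TiltedSite d i j (2 * P + 1) (2 * P + 1) L) d G → ℂ) (hFm : Measurable F)
    (hFb : ∃ C : ℝ, ∀ U, ‖F U‖ ≤ C)
    (hFo : ∀ U V : Config (TiltedSite d i j (2 * P + 1) (2 * P + 1) L) d G, (∀ l, IsRedLink l → U l = V l) → F U = F V) :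
    0 ≤ ∫ U, conj (F (configMidReflect (tiltedUnit d i j (2 * P + 1) (2 * P + 1) L) i (tiltedAxisFlip d L (2 * P + 1) hij) U)) * F U
      ∂(gibbs ρ (tiltedUnit d i j (2 * P + 1) (2 * P + 1) L) β) := by
  classical
  obtain ⟨CF, hFb⟩ := hFb
  -- Step 0: from the Wilson measure to the Boltzmann weight
  have hZ := normaliser_pos (A := TiltedSite d i j (2 * P + 1) (2 * P + 1) L) (G := G) ρ hρ (tiltedUnit d i j (2 * P + 1) (2 * P + 1) L) β
  rw [integral_gibbs]
  simp_rw [Complex.real_smul, Complex.ofReal_div, div_eq_mul_inv, mul_comm (Complex.ofReal _) ((_ : ℂ)⁻¹), mul_assoc]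
  rw [integral_const_mul]
  refine mul_nonneg (by rw [← Complex.ofReal_inv]; exact Complex.zero_le_real.2 (inv_nonneg.2 hZ.le)) ?_
  -- Steps 1–4: split, integrate the three annuli and the free letter, remove the twists; Steps 5–7: double Gram form
  simp_rw [boltzmann_split_red ρ hij hd hρ β F]
  rw [integral_const_mul]
  refine mul_nonneg (mul_nonneg (mul_nonneg (Complex.zero_le_real.2 (Real.exp_pos _).le)
    (Complex.zero_le_real.2 (Real.exp_pos _).le)) (Complex.zero_le_real.2 (Real.exp_pos _).le)) ?_
  rw [integral_hRed_annuli ρ hij hd hρ β hFm hFb hFo]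
  exact integral_hRed_kernels_nonneg ρ hij hd hρ β hFm hFb hFo

/-- **Corollary: the reduced-half link RP blocks of the odd tilted box are positive semidefinite** (two
dimensions, every real `β`): for bounded measurable reduced-half observables `F_1, …, F_n` and `c ∈ ℂ^n`,
`0 ≤ ∑_{a,b} conj c_a · c_b · ⟨conj(F_a ∘ Θ_mid) F_b⟩_β`. -/
theorem tiltedBox_midAxisRP_odd_twoDim_blocks (hij : i ≠ j) (hd : ∀ k : Fin d, k = i ∨ k = j) (hρ : Continuous ρ)
    (β : ℝ) {n : ℕ} (F : Fin n → Config (TiltedSite d i j (2 * P + 1) (2 * P + 1) L) d G → ℂ)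
    (hFm : ∀ a, Measurable (F a)) (hFb : ∀ a, ∃ C : ℝ, ∀ U, ‖F a U‖ ≤ C)
    (hFo : ∀ a, ∀ U V : Config (TiltedSite d i j (2 * P + 1) (2 * P + 1) L) d G, (∀ l, IsRedLink l → U l = V l) → F a U = F a V)
    (c : Fin n → ℂ) :
    0 ≤ ∑ a, ∑ b, conj (c a) * c b *
      ∫ U, conj (F a (configMidReflect (tiltedUnit d i j (2 * P + 1) (2 * P + 1) L) i (tiltedAxisFlip d L (2 * P + 1) hij) U)) * F b U
        ∂(gibbs ρ (tiltedUnit d i j (2 * P + 1) (2 * P + 1) L) β) := by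
  haveI := isProbabilityMeasure_gibbs (A := TiltedSite d i j (2 * P + 1) (2 * P + 1) L) (G := G) ρ hρ
    (tiltedUnit d i j (2 * P + 1) (2 * P + 1) L) β
  have hΘm : Measurable (configMidReflect (G := G) (tiltedUnit d i j (2 * P + 1) (2 * P + 1) L) i
      (tiltedAxisFlip d L (2 * P + 1) hij)) :=
    (measurePreserving_configMidReflect_flip_odd (L := L) (P := P) (G := G) hij).measurable
  -- the combination `H = ∑_b c_b F_b`
  set H : Config (TiltedSite d i j (2 * P + 1) (2 * P + 1) L) d G → ℂ := fun U => ∑ b, c b * F b U with hH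
  have hHm : Measurable H := Finset.measurable_sum _ fun b _ => (hFm b).const_mul _
  choose C hC using hFb
  have hHb : ∃ K : ℝ, ∀ U, ‖H U‖ ≤ K := ⟨∑ b, ‖c b‖ * C b, fun U =>
    (norm_sum_le _ _).trans (Finset.sum_le_sum fun b _ => by
      rw [norm_mul]; exact mul_le_mul_of_nonneg_left (hC b U) (norm_nonneg _))⟩
  have hHo : ∀ U V : Config (TiltedSite d i j (2 * P + 1) (2 * P + 1) L) d G, (∀ l, IsRedLink l → U l = V l) → H U = H V := fun U V hUV => by
    simp only [hH]
    exact Finset.sum_congr rfl fun b _ => by rw [hFo b U V hUV]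
  have key := tiltedBox_midAxisRP_odd_twoDim ρ hij hd hρ β H hHm hHb hHo
  have hint : ∀ a b, Integrable (fun U => conj (F a (configMidReflect (tiltedUnit d i j (2 * P + 1) (2 * P + 1) L) i (tiltedAxisFlip d L (2 * P + 1) hij) U)) * F b U) (gibbs ρ (tiltedUnit d i j (2 * P + 1) (2 * P + 1) L) β) :=
    fun a b => Integrable.of_bound
      (((Complex.continuous_conj.measurable.comp ((hFm a).comp hΘm)).mul (hFm b)).aestronglyMeasurable) (C a * C b)
      (ae_of_all _ fun U => by
        rw [norm_mul, Complex.norm_conj]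
        exact mul_le_mul (hC a _) (hC b U) (norm_nonneg _) ((norm_nonneg (F a U)).trans (hC a U)))
  have hexp : ∫ U, conj (H (configMidReflect (tiltedUnit d i j (2 * P + 1) (2 * P + 1) L) i (tiltedAxisFlip d L (2 * P + 1) hij) U)) * H U ∂(gibbs ρ (tiltedUnit d i j (2 * P + 1) (2 * P + 1) L) β) =
      ∑ a, ∑ b, conj (c a) * c b * ∫ U, conj (F a (configMidReflect (tiltedUnit d i j (2 * P + 1) (2 * P + 1) L) i (tiltedAxisFlip d L (2 * P + 1) hij) U)) * F b U
        ∂(gibbs ρ (tiltedUnit d i j (2 * P + 1) (2 * P + 1) L) β) := by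
    have h1 : ∀ U, conj (H (configMidReflect (tiltedUnit d i j (2 * P + 1) (2 * P + 1) L) i (tiltedAxisFlip d L (2 * P + 1) hij) U)) * H U =
        ∑ a, ∑ b, conj (c a) * c b * (conj (F a (configMidReflect (tiltedUnit d i j (2 * P + 1) (2 * P + 1) L) i (tiltedAxisFlip d L (2 * P + 1) hij) U)) * F b U) := fun U => by
      simp only [hH, map_sum, map_mul]
      rw [Finset.sum_mul_sum]
      exact Finset.sum_congr rfl fun a _ => Finset.sum_congr rfl fun b _ => by ring
    simp_rw [h1]
    rw [integral_finsetSum _ fun a _ => integrable_finsetSum _ fun b _ => (hint a b).const_mul _]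
    refine Finset.sum_congr rfl fun a _ => ?_
    rw [integral_finsetSum _ fun b _ => (hint a b).const_mul _]
    exact Finset.sum_congr rfl fun b _ => integral_const_mul _ _
  rwa [hexp] at key

/-- **The two-dimensional statement, literally**: on `ℤ²/Γ(2P+1, 2P+1)` (`d = 2`, link mirror of the
coordinate `x_0 ↦ 1 - x_0`, mirror partner `x_1`), `P ≥ 1`, every compact second countable `G`, every
continuous `ρ`, every real `β`: the hybrid link mirror is reflection positive for the reduced half
`{1 ≤ x_0 ≤ P}`. -/
theorem tiltedBox_midAxisRP_odd_fin_two (hρ : Continuous ρ) (β : ℝ)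
    (F : Config (TiltedSite 2 0 1 (2 * P + 1) (2 * P + 1) L) 2 G → ℂ) (hFm : Measurable F)
    (hFb : ∃ C : ℝ, ∀ U, ‖F U‖ ≤ C)
    (hFo : ∀ U V : Config (TiltedSite 2 0 1 (2 * P + 1) (2 * P + 1) L) 2 G, (∀ l, IsRedLink l → U l = V l) → F U = F V) :
    0 ≤ ∫ U, conj (F (configMidReflect (tiltedUnit 2 0 1 (2 * P + 1) (2 * P + 1) L) 0
        (tiltedAxisFlip 2 L (2 * P + 1) Fin.zero_ne_one) U)) * F U
      ∂(gibbs ρ (tiltedUnit 2 0 1 (2 * P + 1) (2 * P + 1) L) β) :=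
  tiltedBox_midAxisRP_odd_twoDim ρ Fin.zero_ne_one (fun k => by fin_cases k <;> simp) hρ β F hFm hFb hFo

end TwoDim

end TiltedRP

end Summit.QuantumFields.GaugeBoot

end
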